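import Literature.AnabelianGeometry.SemiGraphs.OverStarSectionRigidity
import HarnessLib

/-!
# Rigidity of functors out of `C_{/A}` known on `A × (−)`: NATURALITY ([SemiAnbd] Def. 2.2 (i), p. 23)

Mochizuki, *Semi-graphs of anabelioids*, Publ. RIMS **42** (2006), §2, Def. 2.2 (i), p. 23
[cite: MochizukiSemiAnbd2006, Def. 2.2(i) p.23].  Sequel to `OverStarSectionRigidity.lean` (abc-iut cell,
layer L3, F-1478 residual «print's finite étale coverings compose», brick (L-K); seat abc-iut-w5-d041):
there, a functor `K : C_{/A} ⥤ C′_{/P}` preserving equalizers, with `K(𝟙_A)` terminal and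
`S ⋙ K ≅ R ⋙ S′` (`S`, `S′` right adjoints of the forgetful functors), was shown to be OBJECTWISE base
change along its section map `σ_K` (`OverStar.isoPullback`).  Here the isomorphisms
`K(Y) ≅ P ×_{σ_K} R(Y.left)` are shown to be NATURAL in `Y` (`OverStar.isoPullback_hom_naturality`): for
`g : Y ⟶ Y′` over `A`, `K(g)` corresponds to the map of pull-backs induced by `R(g.left)`
(`OverStar.pullbackMap`) — what the branch-clause bookkeeping of a composite covering consumes (`K` on
the gluing isomorphisms).  Pure category theory over Mathlib; no `Prop` asserted; nothing here bears
on [IUTchIII] Cor. 3.12.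
-/

namespace Literature.AnabelianGeometry.SemiGraphs

open CategoryTheory CategoryTheory.Limits

universe v u v' u'

namespace OverStar

variable {C : Type u} [Category.{v} C] {A : C} {S : C ⥤ Over A} (adj : Over.forget A ⊣ S)

/-- Naturality of the unit, with clean types: `g ≫ unit_{Y′} = unit_Y ≫ S(g.left)`.
[cite: MochizukiSemiAnbd2006, Def. 2.2(i) p.23] -/
theorem unit'_naturality {Y Y' : Over A} (g : Y ⟶ Y') :
    g ≫ unit' adj Y' = unit' adj Y ≫ S.map g.left :=
  adj.unit.naturality g

section Pullback

variable {C' : Type u'} [Category.{v'} C'] {P : C'} {S' : C' ⥤ Over P} (adj' : Over.forget P ⊣ S')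
  [HasPullbacks C'] {A' Y' Y'' : C'} (σ : P ⟶ A')

/-- The map of pull-backs over `P` induced by a morphism `k : Y′ ⟶ Y″` over `A′`.
[cite: MochizukiSemiAnbd2006, Def. 2.2(i) p.23] -/
noncomputable def pullbackMap {g : Y' ⟶ A'} {g' : Y'' ⟶ A'} (k : Y' ⟶ Y'') (hk : k ≫ g' = g) :
    pullbackObj σ g ⟶ pullbackObj σ g' :=
  Over.homMk (pullback.lift (pullback.fst σ g) (pullback.snd σ g ≫ k)
      (by rw [Category.assoc, hk]; exact pullback.condition))
    (pullback.lift_fst _ _ _)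

/-- The induced map of pull-backs is compatible with the structure maps into `S′`:
`pullbackMap k ≫ pullbackι = pullbackι ≫ S′(k)`. [cite: MochizukiSemiAnbd2006, Def. 2.2(i) p.23] -/
theorem pullbackMap_comp_pullbackι {g : Y' ⟶ A'} {g' : Y'' ⟶ A'} (k : Y' ⟶ Y'') (hk : k ≫ g' = g) :
    pullbackMap σ k hk ≫ pullbackι adj' σ g' = pullbackι adj' σ g ≫ S'.map k := by
  apply tr_injective adj'
  rw [tr_comp_pullbackι, tr_comp_map, tr_pullbackι]
  exact pullback.lift_snd _ _ _

/-- Morphisms into the pull-back over `P` are determined by their composite with `pullbackι` (the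
structure map to `P` being fixed). [cite: MochizukiSemiAnbd2006, Def. 2.2(i) p.23] -/
theorem pullbackObj_hom_ext {g : Y' ⟶ A'} {Z : Over P} {k l : Z ⟶ pullbackObj σ g}
    (h : k ≫ pullbackι adj' σ g = l ≫ pullbackι adj' σ g) : k = l := by
  ext
  apply pullback.hom_ext
  · exact (Over.w k).trans (Over.w l).symm
  · have h' := congrArg (tr adj') h
    rw [tr_comp_pullbackι, tr_comp_pullbackι] at h'
    exact h'

end Pullback

section Rigidity

variable {C' : Type u'} [Category.{v'} C'] {P : C'} {S' : C' ⥤ Over P}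
  (adj' : Over.forget P ⊣ S') (K : Over A ⥤ Over P) (R : C ⥤ C') (ι : S ⋙ K ≅ R ⋙ S')
  (hT : IsTerminal (K.obj (Over.mk (𝟙 A)))) [HasPullbacks C'] [PreservesLimitsOfShape WalkingParallelPair K]

/-- **Naturality of the rigidity isomorphisms**: for `g : Y ⟶ Y′` over `A`, the square
`K(Y) ≅ P ×_{σ_K} R(Y.left) ⟶ P ×_{σ_K} R(Y′.left) ≅ K(Y′)` commutes with `K(g)`, the middle map being
induced by `R(g.left)`. [cite: MochizukiSemiAnbd2006, Def. 2.2(i) p.23] -/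
theorem isoPullback_hom_naturality {Y Y' : Over A} (g : Y ⟶ Y') :
    (isoPullback adj adj' K R ι hT Y).hom ≫
        pullbackMap (sectionMap adj adj' K R ι hT) (R.map g.left)
          (by rw [← R.map_comp, Over.w g]) =
      K.map g ≫ (isoPullback adj adj' K R ι hT Y').hom := by
  apply pullbackObj_hom_ext adj' (sectionMap adj adj' K R ι hT)
  rw [Category.assoc, Category.assoc, pullbackMap_comp_pullbackι, ← Category.assoc,
    isoPullback_hom_comp, isoPullback_hom_comp, Category.assoc, ← ιHom_naturality, ← Category.assoc,
    ← K.map_comp, ← unit'_naturality, K.map_comp, Category.assoc]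

/-- The same, for the inverse isomorphisms. [cite: MochizukiSemiAnbd2006, Def. 2.2(i) p.23] -/
theorem isoPullback_inv_naturality {Y Y' : Over A} (g : Y ⟶ Y') :
    (isoPullback adj adj' K R ι hT Y).inv ≫ K.map g =
      pullbackMap (sectionMap adj adj' K R ι hT) (R.map g.left) (by rw [← R.map_comp, Over.w g]) ≫
        (isoPullback adj adj' K R ι hT Y').inv := by
  rw [Iso.inv_comp_eq, ← Category.assoc, Iso.eq_comp_inv]
  exact (isoPullback_hom_naturality adj adj' K R ι hT g).symm

end Rigidity

end OverStar

end Literature.AnabelianGeometry.SemiGraphs
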